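import Literature.Geometry.Riemannian.MeanConvexSweepSteps
import Literature.Geometry.Riemannian.MeanConvexSweepPrelim
import Literature.Geometry.Riemannian.MeanConvexSurroundingReduction
import Literature.Topology.FourManifolds.EuclideanRegularDomainHessian

/-!
# The mean-convex sweep: Lawson–Michelsohn's Thm. 6.1 from the handle theorem (Thm. 3.1)

Topic `Geometry/Riemannian` (fact seat
`provefact-Literature.Geometry.Riemannian.LawsonMichelsohn1984_surrounding`).  Everything here
is **proved**; no named fact is introduced.

This file runs the sweep of `MeanConvexSweepSteps.lean` over all critical levels of the
normalised Seeley extension `f̃` of the Morse function of the cobordism `(D; ∅, N)`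
(`exists_isMorseFunction_domain`: no critical points of index `m + 1`, `m`, by Milnor's
cancellation theorem and Wall's trading theorem), and discharges the hypothesis `hcores` of
`LawsonMichelsohn1984_surrounding_of_meanConvexCores` (`MeanConvexSurroundingReduction.lean`):

* `sweep_all` — by induction on the number of critical values below a regular level `a < 1`,
  the invariant of the sweep (a diffeomorphism `Φ = id` near `ℝ^{m+1} ∖ D̊` and a regular,
  strictly mean-convex defining function `G` of `Φ{f̃ ≤ a}`) holds at every regular level —
  empty sublevel set at the bottom (a minimum would be a critical point), `sweep_crit` across
  each critical level (given the handle theorem `hG1`) and `sweep_band` in between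
  (Milnor 1963, Thms. 3.1, 3.2; Lawson–Michelsohn 1984, proof of Thm. 6.1: *"`D_f` can be built
  up from a small ball by attaching thin handles of index `≤ n - 2`, and Theorem 3.1 applies at
  each stage"*).
* `LawsonMichelsohn1984_surrounding_of_thinHandles` — **Thm. 6.1 follows from Thm. 3.1** in the
  explicit Euclidean form `hG1` (the statement consumed by `sweep_crit`: mean-convex attachment of
  thin handles of codimension `≥ 2` along the descending discs of the Morse charts of one critical
  level, with the transversality certificate).

What remains for the fact `LawsonMichelsohn1984_surrounding` is exactly `hG1`, i.e.
Lawson–Michelsohn's Thm. 3.1 (the bending construction near the attaching spheres).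

## References

* H. B. Lawson, Jr., M.-L. Michelsohn, *Embedding and surrounding with positive mean curvature*,
  Invent. Math. 77 (1984) 399–419, Thms. 3.1, 6.1. [LawsonMichelsohn1984]
* J. Milnor, *Morse theory*, Ann. of Math. Studies 51 (1963), Thms. 3.1, 3.2. [Milnor1963]
* J. Milnor, *Lectures on the h-cobordism theorem* (1965), Thm. 8.1. [MilnorHCobordism1965]
-/

noncomputable section

open scoped Manifold ContDiff Topology
open Set Function Filter Metric Literature.Topology.FourManifolds

namespace Literature.Geometry.Riemannian

variable {m : ℕ}

/-! ### The sweep over all critical levels -/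

/-- **The invariant of the sweep at every regular level** (induction on the number of critical
values below the level).  `g` is smooth on `ℝ^{m+1}` with compact sublevel sets below `2`,
`{g < 1} ⊆ {F < 0}`, and `C` contains all critical points of `g` below the level `1`, each
nondegenerate of index `≤ m - 1`; `hG1` is the handle theorem (Lawson–Michelsohn Thm. 3.1).
[cite: LawsonMichelsohn1984, proof of Thm. 6.1; Milnor1963, Thms. 3.1, 3.2] -/
theorem sweep_all
    (hG1 : ∀ (f G : EuclideanSpace ℝ (Fin (m + 1)) → ℝ) (c ε R : ℝ) (P : Finset (EuclideanSpace ℝ (Fin (m + 1)))) (lam : EuclideanSpace ℝ (Fin (m + 1)) → ℕ)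
      (e : EuclideanSpace ℝ (Fin (m + 1)) → OpenPartialHomeomorph (EuclideanSpace ℝ (Fin (m + 1))) (EuclideanSpace ℝ (Fin (m + 1)))) (U : Set (EuclideanSpace ℝ (Fin (m + 1)))),
      ContDiff ℝ ∞ f → ContDiff ℝ ∞ G → 0 < ε → 0 < R → 2 * ε ≤ R ^ 2 →
      (∀ p ∈ P, lam p + 1 ≤ m) →
      (∀ p ∈ P, e p ∈ IsManifold.maximalAtlas (𝓡 (m + 1)) ∞ (EuclideanSpace ℝ (Fin (m + 1)))) →
      (∀ p ∈ P, p ∈ (e p).source ∧ e p p = 0) →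
      (∀ p ∈ P, Metric.closedBall (0 : EuclideanSpace ℝ (Fin (m + 1))) R ⊆ (e p).target) →
      (∀ p ∈ P, ∀ y ∈ (e p).target,
        f ((e p).symm y) = c - sqSumLT (lam p) y + sqSumGE (lam p) y) →
      (∀ p ∈ P, ∀ p' ∈ P, p ≠ p' → Disjoint ((e p).symm '' Metric.closedBall (0 : EuclideanSpace ℝ (Fin (m + 1))) R)
        ((e p').symm '' Metric.closedBall (0 : EuclideanSpace ℝ (Fin (m + 1))) R)) →
      IsCompact {x | f x ≤ c + ε} →
      {x | G x ≤ 0} = {x | f x ≤ c - ε} →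
      (∃ s, 0 < s ∧ IsCompact {x | G x ≤ s}) →
      (∀ x, f x = c - ε → fderiv ℝ f x ≠ 0) →
      (∀ x, G x = 0 → fderiv ℝ G x ≠ 0) →
      (∀ x, G x = 0 → ∀ v : Fin m → EuclideanSpace ℝ (Fin (m + 1)), Orthonormal ℝ v →
        (∀ i, fderiv ℝ G x (v i) = 0) → 0 < ∑ i, iteratedFDeriv ℝ 2 G x ![v i, v i]) →
      IsOpen U →
      (∀ p ∈ P, ∀ y : EuclideanSpace ℝ (Fin (m + 1)), (∀ i : Fin (m + 1), lam p ≤ i.val → y i = 0) →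
        sqSumLT (lam p) y ≤ ε → (e p).symm y ∈ U) →
      ∃ (e' : EuclideanSpace ℝ (Fin (m + 1)) → OpenPartialHomeomorph (EuclideanSpace ℝ (Fin (m + 1))) (EuclideanSpace ℝ (Fin (m + 1)))) (G' : EuclideanSpace ℝ (Fin (m + 1)) → ℝ),
        (∀ p ∈ P, e' p ∈ IsManifold.maximalAtlas (𝓡 (m + 1)) ∞ (EuclideanSpace ℝ (Fin (m + 1)))) ∧
        (∀ p ∈ P, p ∈ (e' p).source ∧ e' p p = 0) ∧
        (∀ p ∈ P, Metric.closedBall (0 : EuclideanSpace ℝ (Fin (m + 1))) R ⊆ (e' p).target) ∧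
        (∀ p ∈ P, ∀ y ∈ (e' p).target,
          f ((e' p).symm y) = c - sqSumLT (lam p) y + sqSumGE (lam p) y) ∧
        (∀ p ∈ P, ∀ p' ∈ P, p ≠ p' → Disjoint ((e' p).symm '' Metric.closedBall (0 : EuclideanSpace ℝ (Fin (m + 1))) R)
          ((e' p').symm '' Metric.closedBall (0 : EuclideanSpace ℝ (Fin (m + 1))) R)) ∧
        ContDiff ℝ ∞ G' ∧ {x | G' x ≠ G x} ⊆ U ∧
        (∀ x, f x ≤ c - ε → G' x ≤ 0) ∧
        (∀ p ∈ P, ∀ y : EuclideanSpace ℝ (Fin (m + 1)), (∀ i : Fin (m + 1), lam p ≤ i.val → y i = 0) →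
          sqSumLT (lam p) y ≤ ε → G' ((e' p).symm y) < 0) ∧
        (∃ s, 0 < s ∧ IsCompact {x | G' x ≤ s}) ∧
        (∀ x, G' x = 0 → fderiv ℝ G' x ≠ 0) ∧
        (∀ x, G' x = 0 → ∀ v : Fin m → EuclideanSpace ℝ (Fin (m + 1)), Orthonormal ℝ v →
          (∀ i, fderiv ℝ G' x (v i) = 0) → 0 < ∑ i, iteratedFDeriv ℝ 2 G' x ![v i, v i]) ∧
        (∃ δ, 0 < δ ∧ ∀ x, G' x ≤ 0 → c - ε - δ < f x →
          (x ∉ (⋃ p ∈ P, (e' p).symm '' Metric.closedBall (0 : EuclideanSpace ℝ (Fin (m + 1))) R) ∧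
            ∃ v, 0 < fderiv ℝ f x v ∧ 0 ≤ fderiv ℝ G' x v) ∨
          (∃ p ∈ P, ∃ y ∈ Metric.closedBall (0 : EuclideanSpace ℝ (Fin (m + 1))) R, x = (e' p).symm y ∧
            (y ≠ 0 → ∃ a b : ℝ, 0 ≤ a ∧ 0 ≤ b ∧
              0 < a * sqSumLT (lam p) y + (a + 2 * b) * sqSumGE (lam p) y ∧
              0 ≤ fderiv ℝ (G' ∘ (e' p).symm) y
                (a • milnorModelField (lam p) y + b • (y + milnorModelField (lam p) y))))))
    {F g : EuclideanSpace ℝ (Fin (m + 1)) → ℝ} (hF : Continuous F)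
    (hg : ContDiff ℝ ∞ g) (hsub1 : ∀ x, g x < 1 → F x < 0)
    (hcpt : ∀ s, s < 2 → IsCompact {x | g x ≤ s})
    (C : Finset (EuclideanSpace ℝ (Fin (m + 1)))) (hC : ∀ x, g x < 1 → fderiv ℝ g x = 0 → x ∈ C)
    (hCcrit : ∀ x ∈ C, fderiv ℝ g x = 0)
    (hCnd : ∀ x ∈ C, ∀ u, (∀ v, fderiv ℝ (fderiv ℝ g) x u v = 0) → u = 0)
    (hCind : ∀ x ∈ C,
      sigNeg ((fderiv ℝ (fderiv ℝ g) x).toBilinForm).toQuadraticMap + 1 ≤ m) :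
    ∀ (k : ℕ) (a : ℝ), a < 1 → (∀ x ∈ C, g x ≠ a) → ((C.image g).filter (· < a)).card = k →
      ∃ (η : ℝ) (Φ : EuclideanSpace ℝ (Fin (m + 1)) ≃ₘ⟮𝓘(ℝ, EuclideanSpace ℝ (Fin (m + 1))),
      𝓘(ℝ, EuclideanSpace ℝ (Fin (m + 1)))⟯ EuclideanSpace ℝ (Fin (m + 1))) (G : EuclideanSpace ℝ (Fin (m + 1)) → ℝ),
        0 < η ∧ (∀ x, -η < F x → Φ x = x) ∧ ContDiff ℝ ∞ G ∧
        {x | G x ≤ 0} = Φ '' {x | g x ≤ a} ∧ (∃ s, 0 < s ∧ IsCompact {x | G x ≤ s}) ∧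
        (∀ x, G x = 0 → fderiv ℝ G x ≠ 0) ∧
        (∀ x, G x = 0 → ∀ v : Fin m → EuclideanSpace ℝ (Fin (m + 1)), Orthonormal ℝ v →
        (∀ i, fderiv ℝ G x (v i) = 0) → 0 < ∑ i, iteratedFDeriv ℝ 2 G x ![v i, v i]) := by
  classical
  have hgd : Differentiable ℝ g := hg.differentiable (by simp)
  -- values of critical points below `a` are in the filtered image
  have hval : ∀ a, ∀ x ∈ C, g x < a → g x ∈ (C.image g).filter (· < a) := fun a x hx hxa =>
    Finset.mem_filter.2 ⟨Finset.mem_image_of_mem g hx, hxa⟩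
  intro k
  induction k with
  | zero =>
    intro a ha1 haC hcard
    -- no critical value below `a`: the sublevel set `{g ≤ a}` is empty
    have hempty : {x | g x ≤ a} = ∅ := by
      by_contra hne
      obtain ⟨x₀, hx₀⟩ := nonempty_iff_ne_empty.2 hne
      obtain ⟨x₁, hx₁, hmin⟩ := (hcpt a (by linarith)).exists_isMinOn ⟨x₀, hx₀⟩ hg.continuous.continuousOn
      have hloc : IsLocalMin g x₁ := Filter.Eventually.of_forall fun y => by
        by_cases hy : g y ≤ a
        · exact hmin hy
        · exact le_trans hx₁ (le_of_lt (not_le.1 hy))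
      have hcrit : fderiv ℝ g x₁ = 0 := hloc.fderiv_eq_zero
      have hx₁C : x₁ ∈ C := hC x₁ (lt_of_le_of_lt hx₁ ha1) hcrit
      have hlt : g x₁ < a := lt_of_le_of_ne hx₁ (haC x₁ hx₁C)
      have hmem := hval a x₁ hx₁C hlt
      rw [Finset.card_eq_zero.1 hcard] at hmem
      exact absurd hmem (Finset.notMem_empty _)
    refine ⟨1, Diffeomorph.refl _ _ _, fun _ => 1, one_pos, fun x _ => rfl, contDiff_const, ?_,
      ⟨1 / 2, by norm_num, ?_⟩, fun x hx => ?_, fun x hx => ?_⟩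
    · rw [hempty, image_empty]
      ext x; simp
    · have : {x : EuclideanSpace ℝ (Fin (m + 1)) | (1 : ℝ) ≤ 1 / 2} = ∅ := by ext x; norm_num
      rw [this]; exact isCompact_empty
    · norm_num at hx
    · norm_num at hx
  | succ k ih =>
    intro a ha1 haC hcard
    set CVa := (C.image g).filter (· < a) with hCVa
    have hne : CVa.Nonempty := Finset.card_pos.1 (by rw [hcard]; exact Nat.succ_pos k)
    set c := CVa.max' hne with hc
    have hcmem : c ∈ CVa := Finset.max'_mem _ _
    have hca : c < a := (Finset.mem_filter.1 hcmem).2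
    have hc1 : c < 1 := hca.trans ha1
    have hle_c : ∀ v ∈ C.image g, v < a → v ≤ c := fun v hv hva =>
      Finset.le_max' _ _ (Finset.mem_filter.2 ⟨hv, hva⟩)
    -- the gap below `c` and above `c`
    obtain ⟨g₀, hg₀, hg₀le⟩ := exists_pos_forall_le_finset ((C.image g).filter (· < c))
      (r := fun v => c - v) fun v hv => by
        have := (Finset.mem_filter.1 hv).2; show 0 < c - v; linarith
    set gap : ℝ := min (a - c) g₀ with hgap
    have hgappos : 0 < gap := lt_min (by linarith) hg₀
    have hgap_a : gap ≤ a - c := min_le_left _ _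
    have hgap_lt : ∀ v ∈ C.image g, v < c → v ≤ c - gap := fun v hv hvc => by
      have h1 := hg₀le v (Finset.mem_filter.2 ⟨hv, hvc⟩)
      have h2 : gap ≤ g₀ := min_le_right _ _
      change c - v ≥ g₀ at h1
      linarith
    -- the critical points at the level `c`
    set P : Finset (EuclideanSpace ℝ (Fin (m + 1))) := C.filter fun x => g x = c with hP
    have hPC : ∀ p ∈ P, p ∈ C := fun p hp => (Finset.mem_filter.1 hp).1
    have hPc : ∀ p ∈ P, g p = c := fun p hp => (Finset.mem_filter.1 hp).2
    -- Morse charts at `P`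
    obtain ⟨R, e₀, hR, he₀, hpe₀, hball₀, hquad₀, hdisj₀, -⟩ :=
      exists_morseCharts_finset hg P hPc (fun p hp => hCcrit p (hPC p hp))
        (fun p hp => hCnd p (hPC p hp)) isOpen_univ fun p _ => mem_univ p
    -- the width `ε`
    set ε : ℝ := min (R ^ 2 / 4) (min (gap / 8) ((1 - c) / 8)) with hε
    have hεpos : 0 < ε := lt_min (by positivity) (lt_min (by positivity) (by linarith))
    have hεR : 4 * ε ≤ R ^ 2 := by
      have : ε ≤ R ^ 2 / 4 := min_le_left _ _
      linarith
    have hεgap : 8 * ε ≤ gap := by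
      have : ε ≤ gap / 8 := (min_le_right _ _).trans (min_le_left _ _)
      linarith
    have hε1 : 8 * ε ≤ 1 - c := by
      have : ε ≤ (1 - c) / 8 := (min_le_right _ _).trans (min_le_right _ _)
      linarith
    have hc5 : c + 5 * ε < 1 := by linarith
    -- completeness of `P` near the level `c`
    have hcomplete : ∀ x, g x ∈ Icc (c - 4 * ε) (c + 4 * ε) → fderiv ℝ g x = 0 → x ∈ P := by
      intro x hx h0
      have hxC : x ∈ C := hC x (lt_of_le_of_lt hx.2 (by linarith)) h0
      have hv : g x ∈ C.image g := Finset.mem_image_of_mem g hxC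
      rcases lt_trichotomy (g x) c with h | h | h
      · have := hgap_lt _ hv h; linarith [hx.1]
      · exact Finset.mem_filter.2 ⟨hxC, h⟩
      · have h1 : g x < a := lt_of_le_of_lt hx.2 (by linarith)
        have := hle_c _ hv h1; linarith
    -- the induction hypothesis at `c - ε`
    have haC' : ∀ x ∈ C, g x ≠ c - ε := by
      intro x hx h
      have hv : g x ∈ C.image g := Finset.mem_image_of_mem g hx
      have h1 : g x < c := by rw [h]; linarith
      have := hgap_lt _ hv h1
      linarith
    have hcard' : ((C.image g).filter (· < c - ε)).card = k := by
      have hfilt : (C.image g).filter (· < c - ε) = CVa.erase c := by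
        ext v
        simp only [Finset.mem_filter, Finset.mem_erase, hCVa]
        constructor
        · rintro ⟨hv, hlt⟩
          exact ⟨by intro h; rw [h] at hlt; linarith, hv, by linarith⟩
        · rintro ⟨hne', hv, hva⟩
          have h1 : v ≤ c := hle_c v hv hva
          have h2 : v < c := lt_of_le_of_ne h1 hne'
          have := hgap_lt v hv h2
          exact ⟨hv, by linarith⟩
      rw [hfilt, Finset.card_erase_of_mem hcmem, hcard]
      rfl
    obtain ⟨η, Φ, G, hη, hΦ, hGc, hGset, hGcpt, hGreg, hGmc⟩ :=
      ih (c - ε) (by linarith) haC' hcard'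
    -- across the critical level
    obtain ⟨b, η', Φ', G', hb1, hb2, hη', hΦ', hG'c, hG'set, hG'cpt, hG'reg, hG'mc⟩ :=
      sweep_crit hG1 hF hg hsub1 hcpt hεpos hR hεR hc5 P
        (fun p => sigNeg ((fderiv ℝ (fderiv ℝ g) p).toBilinForm).toQuadraticMap) e₀ he₀ hpe₀
        hball₀ hquad₀ hdisj₀ (fun p hp => hCind p (hPC p hp)) hcomplete hη Φ hΦ hGc hGset
        hGcpt hGreg hGmc
    -- up the band `[b, a]`
    have hba : b ≤ a := by linarith
    have hregba : ∀ x, b ≤ g x → g x ≤ a → fderiv ℝ g x ≠ 0 := by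
      intro x h1 h2 h0
      have hxC : x ∈ C := hC x (lt_of_le_of_lt h2 ha1) h0
      have hv : g x ∈ C.image g := Finset.mem_image_of_mem g hxC
      have hlt : g x < a := lt_of_le_of_ne h2 (haC x hxC)
      have := hle_c _ hv hlt
      linarith
    obtain ⟨η'', Φ'', hη'', hΦ'', himg⟩ := sweep_band hF hg hsub1 hcpt hba ha1 hregba hη' Φ' hΦ'
    exact ⟨η'', Φ'', G', hη'', hΦ'', hG'c, by rw [himg, hG'set], hG'cpt, hG'reg, hG'mc⟩


/-! ### Discharge of `hcores`: Thm. 6.1 from Thm. 3.1 -/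

/-- **Lawson–Michelsohn's Thm. 6.1 from the handle theorem (Thm. 3.1).**  If thin handles of
codimension `≥ 2` can be attached to strictly mean-convex compact regular domains of `ℝ^{m+1}`
keeping strict mean convexity — in the explicit Euclidean form `hG1` consumed by the sweep
(`sweep_crit`: along the descending discs of the Morse charts of one critical level, inside any
prescribed open set, with the transversality certificate) — then every `1`-thin compact domain
of `ℝ^{m+1}`, `m ≥ 4`, is surrounded by a strictly mean-convex hypersurface through a strong
isotopy of its boundary (`LawsonMichelsohn1984_surrounding`).
[cite: LawsonMichelsohn1984, Thms. 3.1, 6.1] -/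
theorem LawsonMichelsohn1984_surrounding_of_thinHandles
    (hG1 : ∀ m : ℕ, 4 ≤ m →
      ∀ (f G : EuclideanSpace ℝ (Fin (m + 1)) → ℝ) (c ε R : ℝ) (P : Finset (EuclideanSpace ℝ (Fin (m + 1)))) (lam : EuclideanSpace ℝ (Fin (m + 1)) → ℕ)
      (e : EuclideanSpace ℝ (Fin (m + 1)) → OpenPartialHomeomorph (EuclideanSpace ℝ (Fin (m + 1))) (EuclideanSpace ℝ (Fin (m + 1)))) (U : Set (EuclideanSpace ℝ (Fin (m + 1)))),
      ContDiff ℝ ∞ f → ContDiff ℝ ∞ G → 0 < ε → 0 < R → 2 * ε ≤ R ^ 2 →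
      (∀ p ∈ P, lam p + 1 ≤ m) →
      (∀ p ∈ P, e p ∈ IsManifold.maximalAtlas (𝓡 (m + 1)) ∞ (EuclideanSpace ℝ (Fin (m + 1)))) →
      (∀ p ∈ P, p ∈ (e p).source ∧ e p p = 0) →
      (∀ p ∈ P, Metric.closedBall (0 : EuclideanSpace ℝ (Fin (m + 1))) R ⊆ (e p).target) →
      (∀ p ∈ P, ∀ y ∈ (e p).target,
        f ((e p).symm y) = c - sqSumLT (lam p) y + sqSumGE (lam p) y) →
      (∀ p ∈ P, ∀ p' ∈ P, p ≠ p' → Disjoint ((e p).symm '' Metric.closedBall (0 : EuclideanSpace ℝ (Fin (m + 1))) R)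
        ((e p').symm '' Metric.closedBall (0 : EuclideanSpace ℝ (Fin (m + 1))) R)) →
      IsCompact {x | f x ≤ c + ε} →
      {x | G x ≤ 0} = {x | f x ≤ c - ε} →
      (∃ s, 0 < s ∧ IsCompact {x | G x ≤ s}) →
      (∀ x, f x = c - ε → fderiv ℝ f x ≠ 0) →
      (∀ x, G x = 0 → fderiv ℝ G x ≠ 0) →
      (∀ x, G x = 0 → ∀ v : Fin m → EuclideanSpace ℝ (Fin (m + 1)), Orthonormal ℝ v →
        (∀ i, fderiv ℝ G x (v i) = 0) → 0 < ∑ i, iteratedFDeriv ℝ 2 G x ![v i, v i]) →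
      IsOpen U →
      (∀ p ∈ P, ∀ y : EuclideanSpace ℝ (Fin (m + 1)), (∀ i : Fin (m + 1), lam p ≤ i.val → y i = 0) →
        sqSumLT (lam p) y ≤ ε → (e p).symm y ∈ U) →
      ∃ (e' : EuclideanSpace ℝ (Fin (m + 1)) → OpenPartialHomeomorph (EuclideanSpace ℝ (Fin (m + 1))) (EuclideanSpace ℝ (Fin (m + 1)))) (G' : EuclideanSpace ℝ (Fin (m + 1)) → ℝ),
        (∀ p ∈ P, e' p ∈ IsManifold.maximalAtlas (𝓡 (m + 1)) ∞ (EuclideanSpace ℝ (Fin (m + 1)))) ∧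
        (∀ p ∈ P, p ∈ (e' p).source ∧ e' p p = 0) ∧
        (∀ p ∈ P, Metric.closedBall (0 : EuclideanSpace ℝ (Fin (m + 1))) R ⊆ (e' p).target) ∧
        (∀ p ∈ P, ∀ y ∈ (e' p).target,
          f ((e' p).symm y) = c - sqSumLT (lam p) y + sqSumGE (lam p) y) ∧
        (∀ p ∈ P, ∀ p' ∈ P, p ≠ p' → Disjoint ((e' p).symm '' Metric.closedBall (0 : EuclideanSpace ℝ (Fin (m + 1))) R)
          ((e' p').symm '' Metric.closedBall (0 : EuclideanSpace ℝ (Fin (m + 1))) R)) ∧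
        ContDiff ℝ ∞ G' ∧ {x | G' x ≠ G x} ⊆ U ∧
        (∀ x, f x ≤ c - ε → G' x ≤ 0) ∧
        (∀ p ∈ P, ∀ y : EuclideanSpace ℝ (Fin (m + 1)), (∀ i : Fin (m + 1), lam p ≤ i.val → y i = 0) →
          sqSumLT (lam p) y ≤ ε → G' ((e' p).symm y) < 0) ∧
        (∃ s, 0 < s ∧ IsCompact {x | G' x ≤ s}) ∧
        (∀ x, G' x = 0 → fderiv ℝ G' x ≠ 0) ∧
        (∀ x, G' x = 0 → ∀ v : Fin m → EuclideanSpace ℝ (Fin (m + 1)), Orthonormal ℝ v →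
          (∀ i, fderiv ℝ G' x (v i) = 0) → 0 < ∑ i, iteratedFDeriv ℝ 2 G' x ![v i, v i]) ∧
        (∃ δ, 0 < δ ∧ ∀ x, G' x ≤ 0 → c - ε - δ < f x →
          (x ∉ (⋃ p ∈ P, (e' p).symm '' Metric.closedBall (0 : EuclideanSpace ℝ (Fin (m + 1))) R) ∧
            ∃ v, 0 < fderiv ℝ f x v ∧ 0 ≤ fderiv ℝ G' x v) ∨
          (∃ p ∈ P, ∃ y ∈ Metric.closedBall (0 : EuclideanSpace ℝ (Fin (m + 1))) R, x = (e' p).symm y ∧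
            (y ≠ 0 → ∃ a b : ℝ, 0 ≤ a ∧ 0 ≤ b ∧
              0 < a * sqSumLT (lam p) y + (a + 2 * b) * sqSumGE (lam p) y ∧
              0 ≤ fderiv ℝ (G' ∘ (e' p).symm) y
                (a • milnorModelField (lam p) y + b • (y + milnorModelField (lam p) y)))))) :
    LawsonMichelsohn1984_surrounding := by
  classical
  refine LawsonMichelsohn1984_surrounding_of_meanConvexCores ?_
  intro m hm N _ _ _ _ _ _ _ F e h he hrange f h1 hf htop hmid
  have hm1 : 1 ≤ m := by omega
  have hF := h.contDiff
  have hD := h.isCompact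
  have hreg := h.fderiv_ne_zero
  -- the Seeley extension of `f`
  have hfs : ContMDiff (𝓡∂ (m + 1)) 𝓘(ℝ, ℝ) ∞ f := hf.isMorse.contMDiff
  obtain ⟨fe, hfe, hfef⟩ := h.exists_contDiff_forall_eq hfs
  have hfeq : f = fe ∘ IsRegularCompactDomain.Domain.incl h := funext fun p => (hfef p).symm
  have hcritiff : ∀ p : h.Domain, IsMCriticalPt (𝓡∂ (m + 1)) f p ↔
      fderiv ℝ fe (IsRegularCompactDomain.Domain.incl h p) = 0 := fun p => by
    rw [hfeq]; exact h.isMCriticalPt_comp_incl_iff hm1 hfe p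
  -- values of `f`: `1` on `{F = 0}`, `< 1` on `{F < 0}`; `dfe ≠ 0` on `{F = 0}`
  have hfe1 : ∀ x, F x = 0 → fe x = 1 := by
    intro x hx
    obtain ⟨p, hp⟩ := (IsRegularCompactDomain.Domain.range_incl_comp_val_boundary h).symm.subset hx
    have hpb : p.1 ∈ range (h.cobordismOfEmbedding (by omega) he hrange).inr := by
      rw [h.range_cobordismOfEmbedding_inr (by omega) he hrange]; exact p.2
    obtain ⟨y, hy⟩ := hpb
    rw [← hp, hfef, ← hy]
    exact hf.2.2.1 y
  have hfelt : ∀ x, F x < 0 → fe x < 1 := by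
    intro x hx
    have hint := (IsRegularCompactDomain.Domain.isInteriorPoint_iff h
      (IsRegularCompactDomain.Domain.mk h x hx.le)).2 hx
    have := hf.2.2.2.2 _ hint
    rw [hfeq] at this
    exact this.2
  have hfereg : ∀ x, F x = 0 → fderiv ℝ fe x ≠ 0 := by
    intro x hx h0
    set p := IsRegularCompactDomain.Domain.mk h x hx.le
    have hpb : p ∈ (𝓡∂ (m + 1)).boundary h.Domain :=
      (IsRegularCompactDomain.Domain.mem_boundary_iff h p).2 hx
    exact hf.2.2.2.1 p hpb ((hcritiff p).2 h0)
  -- the normalised clock `g`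
  obtain ⟨g, hgc, ⟨U, hUo, hDU, hgU⟩, -, hle1, heq1, hcpt⟩ :=
    exists_normalised_clock hF hD hreg hfe hfe1 hfelt hfereg
  have hsub1 : ∀ x, g x < 1 → F x < 0 := fun x hx => by
    have h1 : F x ≤ 0 := (hle1 x).1 hx.le
    rcases h1.lt_or_eq with h2 | h2
    · exact h2
    · have := (heq1 x).2 h2; linarith
  have hgev : ∀ x, F x ≤ 0 → g =ᶠ[𝓝 x] fe := fun x hx =>
    (hUo.eventually_mem (hDU hx)).mono fun y hy => hgU y hy
  have hgfe : ∀ x, F x ≤ 0 → g x = fe x := fun x hx => hgU x (hDU hx)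
  have hgD1 : ∀ x, F x ≤ 0 → fderiv ℝ g x = fderiv ℝ fe x := fun x hx => (hgev x hx).fderiv_eq
  have hgD2 : ∀ x, F x ≤ 0 → fderiv ℝ (fderiv ℝ g) x = fderiv ℝ (fderiv ℝ fe) x := fun x hx =>
    (hgev x hx).fderiv.fderiv_eq
  -- the critical points below the level `1`
  have hfin : (criticalSet (𝓡∂ (m + 1)) f).Finite := IsMorse.finite_criticalSet_holds hf.isMorse
  set C : Finset (EuclideanSpace ℝ (Fin (m + 1))) := hfin.toFinset.image (IsRegularCompactDomain.Domain.incl h) with hC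
  have hCmem : ∀ x, x ∈ C ↔ ∃ p : h.Domain, IsMCriticalPt (𝓡∂ (m + 1)) f p ∧
      IsRegularCompactDomain.Domain.incl h p = x := fun x => by
    simp [hC]
  have hcritF : ∀ p : h.Domain, IsMCriticalPt (𝓡∂ (m + 1)) f p →
      F (IsRegularCompactDomain.Domain.incl h p) < 0 := by
    intro p hp
    rcases (IsRegularCompactDomain.Domain.apply_incl_nonpos h p).lt_or_eq with h' | h'
    · exact h'
    · exact absurd hp (hf.2.2.2.1 p ((IsRegularCompactDomain.Domain.mem_boundary_iff h p).2 h'))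
  have hCcrit' : ∀ x, g x < 1 → fderiv ℝ g x = 0 → x ∈ C := by
    intro x hx h0
    have hFx : F x < 0 := hsub1 x hx
    set p := IsRegularCompactDomain.Domain.mk h x hFx.le
    refine (hCmem x).2 ⟨p, (hcritiff p).2 ?_, rfl⟩
    show fderiv ℝ fe x = 0
    rw [← hgD1 x hFx.le]; exact h0
  have hCcrit : ∀ x ∈ C, fderiv ℝ g x = 0 := by
    intro x hx
    obtain ⟨p, hp, rfl⟩ := (hCmem x).1 hx
    rw [hgD1 _ (IsRegularCompactDomain.Domain.apply_incl_nonpos h p)]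
    exact (hcritiff p).1 hp
  have hCval : ∀ x ∈ C, ∃ p : h.Domain, IsMCriticalPt (𝓡∂ (m + 1)) f p ∧
      IsRegularCompactDomain.Domain.incl h p = x ∧ g x = f p := by
    intro x hx
    obtain ⟨p, hp, rfl⟩ := (hCmem x).1 hx
    exact ⟨p, hp, rfl, by rw [hgfe _ (IsRegularCompactDomain.Domain.apply_incl_nonpos h p), hfef]⟩
  have hCg : ∀ x ∈ C, g x < 1 := by
    intro x hx
    obtain ⟨p, hp, rfl, hval⟩ := hCval x hx
    rw [hgfe _ (IsRegularCompactDomain.Domain.apply_incl_nonpos h p)]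
    exact hfelt _ (hcritF p hp)
  have hCnd : ∀ x ∈ C, ∀ u, (∀ v, fderiv ℝ (fderiv ℝ g) x u v = 0) → u = 0 := by
    intro x hx
    obtain ⟨p, hp, rfl⟩ := (hCmem x).1 hx
    have hneg := hcritF p hp
    rw [hgD2 _ hneg.le]
    have hnd : (mhessian (𝓡∂ (m + 1)) f p).Nondegenerate := hf.isMorse.2 p hp
    rw [hfeq] at hnd
    exact h.forall_fderiv_fderiv_eq_zero_of_nondegenerate (hfe.of_le (by norm_cast)) p hneg
      ((hcritiff p).1 hp) hnd
  have hCind : ∀ x ∈ C,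
      sigNeg ((fderiv ℝ (fderiv ℝ g) x).toBilinForm).toQuadraticMap + 1 ≤ m := by
    intro x hx
    obtain ⟨p, hp, rfl⟩ := (hCmem x).1 hx
    have hneg := hcritF p hp
    rw [hgD2 _ hneg.le]
    have hidx : morseIndex (𝓡∂ (m + 1)) f p =
        sigNeg ((fderiv ℝ (fderiv ℝ fe) (IsRegularCompactDomain.Domain.incl h p)).toBilinForm).toQuadraticMap := by
      rw [hfeq]
      exact h.morseIndex_comp_incl_eq_sigNeg (hfe.of_le (by norm_cast)) p hneg ((hcritiff p).1 hp)
    rw [← hidx]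
    have hle : morseIndex (𝓡∂ (m + 1)) f p ≤ m + 1 := by
      have := morseIndex_le_finrank (𝓡∂ (m + 1)) f p
      rwa [finrank_euclideanSpace_fin] at this
    have hne1 : morseIndex (𝓡∂ (m + 1)) f p ≠ m + 1 := fun h' => by
      have : p ∈ criticalSetOfIndex (𝓡∂ (m + 1)) f (m + 1) := ⟨hp, h'⟩
      rw [htop] at this; exact this
    have hne2 : morseIndex (𝓡∂ (m + 1)) f p ≠ m := fun h' => by
      have : p ∈ criticalSetOfIndex (𝓡∂ (m + 1)) f m := ⟨hp, h'⟩
      rw [hmid] at this; exact this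
    omega
  -- a regular level `a₀ < 1` above all critical values
  obtain ⟨ρ, hρ, hρle⟩ := exists_pos_forall_le_finset (C.image g) (r := fun v => 1 - v)
    fun v hv => by
      obtain ⟨x, hx, rfl⟩ := Finset.mem_image.1 hv
      show 0 < 1 - g x; linarith [hCg x hx]
  set a₀ : ℝ := 1 - ρ / 2 with ha₀
  have ha₀1 : a₀ < 1 := by rw [ha₀]; linarith
  have hCa₀ : ∀ x ∈ C, g x < a₀ := fun x hx => by
    have := hρle (g x) (Finset.mem_image_of_mem g hx)
    change ρ ≤ 1 - g x at this
    rw [ha₀]; linarith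
  -- the sweep
  obtain ⟨η, Φ, G, hη, hΦ, hGc, hGset, -, hGreg, hGmc⟩ :=
    sweep_all (hG1 m hm) hF.continuous hgc hsub1 hcpt C hCcrit' hCcrit hCnd hCind _ a₀ ha₀1
      (fun x hx => (hCa₀ x hx).ne) rfl
  -- regularity of `g` at the level `a₀`
  have hga₀reg : ∀ x, g x = a₀ → fderiv ℝ g x ≠ 0 := fun x hx h0 => by
    have hxC := hCcrit' x (by rw [hx]; exact ha₀1) h0
    exact (hCa₀ x hxC).ne hx
  refine ⟨a₀, η, Φ, G, fun p hp => ?_, ha₀1, hη, hΦ, hGc, ?_, hGreg, ?_, hGmc⟩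
  · -- critical values are below `a₀`
    have hx : IsRegularCompactDomain.Domain.incl h p ∈ C := (hCmem _).2 ⟨p, hp, rfl⟩
    have := hCa₀ _ hx
    rwa [hgfe _ (IsRegularCompactDomain.Domain.apply_incl_nonpos h p), hfef] at this
  · -- `{G ≤ 0}` is compact
    rw [hGset]; exact (hcpt a₀ (by linarith)).image Φ.continuous
  · -- `{G = 0} = Φ(incl(f⁻¹{a₀}))`
    have h1 : {x | G x = 0} = frontier {x | G x ≤ 0} :=
      (frontier_setOf_nonpos_eq hGc.continuous hGreg).symm
    have h2 : frontier {x : EuclideanSpace ℝ (Fin (m + 1)) | g x ≤ a₀} = {x | g x = a₀} := by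
      have hc' : Continuous fun x => g x - a₀ := hgc.continuous.sub continuous_const
      have hr' : ∀ x, g x - a₀ = 0 → fderiv ℝ (fun x => g x - a₀) x ≠ 0 := fun x hx => by
        rw [fderiv_sub_const]; exact hga₀reg x (by linarith)
      have h3 := frontier_setOf_nonpos_eq hc' hr'
      have e1 : {x : EuclideanSpace ℝ (Fin (m + 1)) | g x - a₀ ≤ 0} = {x | g x ≤ a₀} := by ext x; simp
      have e2 : {x : EuclideanSpace ℝ (Fin (m + 1)) | g x - a₀ = 0} = {x | g x = a₀} := by ext x; simp [sub_eq_zero]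
      rwa [e1, e2] at h3
    have h3 : {x : EuclideanSpace ℝ (Fin (m + 1)) | g x = a₀} =
        IsRegularCompactDomain.Domain.incl h '' (f ⁻¹' {a₀}) := by
      ext x
      constructor
      · intro hx
        have hxa : g x = a₀ := hx
        have hFx : F x < 0 := hsub1 x (by rw [hxa]; exact ha₀1)
        refine ⟨IsRegularCompactDomain.Domain.mk h x hFx.le, ?_, rfl⟩
        show f _ = a₀
        rw [hfeq]
        show fe x = a₀
        rw [← hgfe x hFx.le]; exact hxa
      · rintro ⟨p, hp, rfl⟩
        have hpa : f p = a₀ := hp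
        show g _ = a₀
        rw [hgfe _ (IsRegularCompactDomain.Domain.apply_incl_nonpos h p), hfef, hpa]
    have key : frontier ((Φ : EuclideanSpace ℝ (Fin (m + 1)) → EuclideanSpace ℝ (Fin (m + 1))) ''
        {x | g x ≤ a₀}) = Φ '' {x | g x = a₀} := by
      rw [← h2]
      exact (Φ.toHomeomorph.image_frontier {x | g x ≤ a₀}).symm
    refine h1.trans ((congrArg frontier hGset).trans (key.trans ?_))
    exact congrArg (fun s => (Φ : EuclideanSpace ℝ (Fin (m + 1)) → EuclideanSpace ℝ (Fin (m + 1))) '' s) h3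

end Literature.Geometry.Riemannian

end
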